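import Summits.NavierStokesRegularity.NavierStokesRegularity.Theses.AdaptedFrequency
import Literature.Analysis.FluidPDE.AdaptedBackwardKernel
import Literature.Analysis.FluidPDE.ClassicalSolution
import Literature.Analysis.FluidPDE.LerayProfileCalculus
import Literature.Analysis.FluidPDE.LocalLerayCylinderSliceNorms
import Literature.Analysis.FluidPDE.MildSolutionProofs
import Summits.NavierStokesRegularity.NavierStokesRegularity.Theorems.AdaptedFrequencyAdaptedFrequencyConvergesStubKernelCalculusCore
import Summits.NavierStokesRegularity.NavierStokesRegularity.Theorems.AdaptedFrequencyAdaptedFrequencyConvergesBernoulliCloudIdentityIBP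
import HarnessLib

/-!
# The Bernoulli–cloud identity `d/dt ∫ ½|u|² G = ∫ p (u·∇G + νΔG) − ν H` — crux
# stmt-NavierStokesRegularity-10493 (`AdaptedFrequency.AdaptedFrequencyConverges`), line
# cloud-frame-effective-tsai (lead c1 by-product: card lever 2)

Theorems only (`--supports stmt-NavierStokesRegularity-10493`). Let `(u, p)` be a classical
solution of the unforced Navier–Stokes system with viscosity `ν` on an open time set `S₀`
(`IsClassicalNSSolutionOn S₀ ν 0 u p`: `∂ₜu + (u·∇)u = νΔu − ∇p`, `div u = 0`) and `G` a
flow-adapted backward kernel of `∂ₜ + u·∇ − νΔ` on `S ⊇ S₀` (`IsAdaptedBackwardKernel`: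
`∂ₜG + u·∇G + νΔG = 0`, `∫ G = 1`). With the kernel-weighted energy `B(t) = ∫ ½‖u(t)‖² G(t)` and
the adapted enstrophy `H(t) = adaptedEnstrophy u G t = ∫ ‖curl u(t)‖² G(t)`:

* `laplacian_pressure_eq` — the **pressure Poisson equation in vorticity form**
  `Δp = ‖curl u‖² − |∇u|²` (`|·|²` the Frobenius norm `frobeniusNormSq`): the tree's
  `laplacian_pressure_eq_of_isClassicalNSSolutionOn` (`Δp = −div((u·∇)u)`, Tao 2013 (8)),
  `div((u·∇)u) = tr(Du ∘ Du)` for `div u = 0` and `|Du|² = ‖curl u‖² + tr(Du ∘ Du)` on `ℝ³`;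
* `bernoulliCloud_density` — `(∂ₜ + u·∇ − νΔ)‖u‖² = −2 u·∇p − 2ν|∇u|²` pointwise;
* `bernoulliCloud_hasDerivAt_of_bounds` — the energy form
  `B′ = −∫ (u·∇p) G + ν ∫ (Δp) G − ν H` under uniform bounds on `u, Du, D²u, ∂ₜu` on `S₀` and an
  integrable majorant of `G` (no decay of `∇G` needed): the transport-free first variation
  `d/dt ∫ qG = ∫ (∂ₜq + u·∇q − νΔq) G` of the tree (`kernelCalculus_hasDerivAt_integral_mul_kernel`)
  with `q = ‖u‖²`, the density identity and the Poisson equation;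
* `bernoulliCloud_hasDerivAt` — **THE BERNOULLI–CLOUD IDENTITY** `B′(t) = ∫ p (u·∇G + νΔG) − ν H(t)`
  (i.e. `ν H = −∫ p ∂ₜG − dB/dt` by the adjoint equation; a steady cloud has `H = 0` — Tsai's
  theorem in one line), adding linear growth of `p` and integrability of `(1 + ‖x‖)‖∇G‖`,
  `(1 + ‖x‖)|ΔG|`: the energy form plus the whole-space integrations by parts of
  `…BernoulliCloudIdentityIBP` (`∫ p u·∇G = −∫ (u·∇p) G` by `div u = 0`, `∫ p ΔG = ∫ (Δp) G`).
  This is the first identity of the route that uses the momentum equation with its pressure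
  rather than the vorticity equation.

References: T.-P. Tsai, ARMA 143 (1998) §5 (head-pressure computation); A. Friedman, *PDE of
parabolic type* (1964), Ch. 1 §8 (adjoint equation); T. Tao, Anal. PDE 6 (2013), (8).
-/

noncomputable section

namespace Summit.NavierStokesRegularity.NavierStokesRegularity.Theorems.AdaptedFrequencyConverges.CloudFrameEffectiveTsai

open scoped Topology InnerProductSpace RealInnerProductSpace Laplacian ContDiff
open Literature.Analysis.FluidPDE Set Filter MeasureTheory Function Metric
open Summit.NavierStokesRegularity.NavierStokesRegularity.Theorems.AdaptedFrequencyConverges.TauberianOmegaLimit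

section R3

/-- **Pressure Poisson equation in vorticity form.** For a classical solution of the unforced
Navier–Stokes system on an open time set `S₀` and `t ∈ S₀`,
`Δ p(t)(x) = ‖curl u(t)(x)‖² − |Du(t)(x)|²` (Frobenius norm): `Δp = −div((u·∇)u) = −tr(Du∘Du)`
(incompressibility) and `|Du|² = ‖curl u‖² + tr(Du∘Du)` pointwise on `ℝ³`. -/
theorem laplacian_pressure_eq {S₀ : Set ℝ} {ν : ℝ}
    {u : ℝ → EuclideanSpace ℝ (Fin 3) → EuclideanSpace ℝ (Fin 3)}
    {p : ℝ → EuclideanSpace ℝ (Fin 3) → ℝ}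
    (hcl : IsClassicalNSSolutionOn S₀ ν 0 u p) (hS₀ : IsOpen S₀) {t : ℝ} (ht : t ∈ S₀)
    (x : EuclideanSpace ℝ (Fin 3)) :
    (Δ (p t)) x = ‖curl (u t) x‖ ^ 2 - frobeniusNormSq (fderiv ℝ (u t) x) := by
  have h1 := laplacian_pressure_eq_of_isClassicalNSSolutionOn hcl
    (show t ∈ interior S₀ by rwa [hS₀.interior_eq]) x
  have hu2 : ContDiff ℝ 2 (u t) := (hcl.contDiff_velocity ht).of_le (by norm_cast)
  have h0 : VectorCalculus.divergence
      ((0 : ℝ → EuclideanSpace ℝ (Fin 3) → EuclideanSpace ℝ (Fin 3)) t) x = 0 := by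
    simp [VectorCalculus.divergence, Pi.zero_def]
  rw [h1, h0, add_zero, divergence_convect_self_eq hu2 (hcl.divFree t ht),
    frobeniusNormSq_fderiv_eq_sq_norm_curl_add_trace]
  ring

/-- **The density identity.** For a classical solution of the unforced Navier–Stokes system on an
open time set `S₀`, at `t ∈ S₀` and every `x`:
`∂ₜ‖u‖² + u·∇‖u‖² − νΔ‖u‖² = −2 Dp[u] − 2ν|Du|²` — pair the momentum equation
`∂ₜu + (u·∇)u − νΔu = −∇p` with `2u` and use `Δ‖u‖² = 2⟪Δu, u⟫ + 2|Du|²`. -/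
theorem bernoulliCloud_density {S₀ : Set ℝ} {ν : ℝ}
    {u : ℝ → EuclideanSpace ℝ (Fin 3) → EuclideanSpace ℝ (Fin 3)}
    {p : ℝ → EuclideanSpace ℝ (Fin 3) → ℝ}
    (hcl : IsClassicalNSSolutionOn S₀ ν 0 u p) (hS₀ : IsOpen S₀) {t : ℝ} (ht : t ∈ S₀)
    (x : EuclideanSpace ℝ (Fin 3)) :
    deriv (fun s => ‖u s x‖ ^ 2) t + fderiv ℝ (fun y => ‖u t y‖ ^ 2) x (u t x) -
        ν * (Δ (fun y => ‖u t y‖ ^ 2)) x =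
      -(2 * fderiv ℝ (p t) x (u t x)) - 2 * ν * frobeniusNormSq (fderiv ℝ (u t) x) := by
  have hu2 : ContDiff ℝ 2 (u t) := (hcl.contDiff_velocity ht).of_le (by norm_cast)
  have hud : DifferentiableAt ℝ (u t) x := (hu2.differentiable (by norm_num)) x
  have hline := hcl.smooth_velocity.hasDerivAt_timeLine hS₀ ht x
  -- the three terms
  have hfun : (fun y => ‖u t y‖ ^ 2) = fun y => ⟪u t y, u t y⟫ := by
    funext y; rw [real_inner_self_eq_norm_sq]
  have h1 : deriv (fun s => ‖u s x‖ ^ 2) t = 2 * ⟪u t x, deriv (fun s => u s x) t⟫ := by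
    simp_rw [← real_inner_self_eq_norm_sq]
    rw [(hline.inner ℝ hline).deriv, real_inner_comm (deriv (fun s => u s x) t)]
    ring
  have h2 : fderiv ℝ (fun y => ‖u t y‖ ^ 2) x (u t x) = 2 * ⟪u t x, fderiv ℝ (u t) x (u t x)⟫ := by
    rw [hfun, fderiv_inner_apply ℝ hud hud, real_inner_comm (fderiv ℝ (u t) x (u t x))]
    ring
  have h3 : (Δ (fun y => ‖u t y‖ ^ 2)) x =
      2 * ⟪(Δ (u t)) x, u t x⟫ + 2 * frobeniusNormSq (fderiv ℝ (u t) x) := by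
    rw [hfun]; exact laplacian_inner_self_eq hu2 x
  -- the momentum equation at `(t, x)`
  have hm := hcl.momentum t ht x
  rw [timeDerivWithin_eq_deriv hS₀ ht] at hm
  simp only [convect_apply, Pi.zero_apply, add_zero] at hm
  have h5 : deriv (fun s => u s x) t =
      ν • (Δ (u t)) x - gradient (p t) x - fderiv ℝ (u t) x (u t x) := by
    rw [← hm]; abel
  have h4 : ⟪u t x, gradient (p t) x⟫ = fderiv ℝ (p t) x (u t x) := by
    rw [real_inner_comm, gradient, InnerProductSpace.toDual_symm_apply]
  have h6 : ⟪u t x, (Δ (u t)) x⟫ = ⟪(Δ (u t)) x, u t x⟫ := real_inner_comm _ _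
  rw [h1, h2, h3, h5, inner_sub_right, inner_sub_right, inner_smul_right, h4, h6]
  ring

/-- **Bounds on `∇p` and `Δp` read off the equations.** For a classical solution of the unforced
Navier–Stokes system on an open `S₀`, at a time `t ∈ S₀` where `‖u‖, ‖Du‖, ‖D²u‖, ‖∂ₜu‖ ≤ K`:
`‖Dp‖ ≤ 3|ν|K + K + K²` (momentum equation `∇p = νΔu − ∂ₜu − (u·∇)u`, `‖Δu‖ ≤ 3‖D²u‖`) and
`|Δp| ≤ (‖curl‖_op K)² + 3K²` (`laplacian_pressure_eq`). -/
theorem bernoulliCloud_pressure_bounds {S₀ : Set ℝ} {ν K : ℝ}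
    {u : ℝ → EuclideanSpace ℝ (Fin 3) → EuclideanSpace ℝ (Fin 3)}
    {p : ℝ → EuclideanSpace ℝ (Fin 3) → ℝ}
    (hcl : IsClassicalNSSolutionOn S₀ ν 0 u p) (hS₀ : IsOpen S₀) {t : ℝ} (ht : t ∈ S₀)
    (hU : ∀ x, ‖u t x‖ ≤ K) (hDu : ∀ x, ‖fderiv ℝ (u t) x‖ ≤ K)
    (hD2u : ∀ x, ‖iteratedFDeriv ℝ 2 (u t) x‖ ≤ K) (hut : ∀ x, ‖deriv (fun s => u s x) t‖ ≤ K)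
    (x : EuclideanSpace ℝ (Fin 3)) :
    ‖fderiv ℝ (p t) x‖ ≤ |ν| * (3 * K) + K + K * K ∧
      |(Δ (p t)) x| ≤ (‖curlCLM‖ * K) ^ 2 + 3 * K ^ 2 := by
  have hK0 : 0 ≤ K := (norm_nonneg _).trans (hU 0)
  constructor
  · have hm := hcl.momentum t ht x
    rw [timeDerivWithin_eq_deriv hS₀ ht] at hm
    simp only [convect_apply, Pi.zero_apply, add_zero] at hm
    have h5 : gradient (p t) x =
        ν • (Δ (u t)) x - deriv (fun s => u s x) t - fderiv ℝ (u t) x (u t x) := by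
      have h6 : gradient (p t) x =
          ν • (Δ (u t)) x - (deriv (fun s => u s x) t + fderiv ℝ (u t) x (u t x)) := by
        rw [hm]; abel
      rw [h6]; abel
    rw [← (InnerProductSpace.toDual ℝ (EuclideanSpace ℝ (Fin 3))).symm.norm_map, ← gradient, h5]
    have h1 : ‖ν • (Δ (u t)) x‖ ≤ |ν| * (3 * K) := by
      rw [norm_smul, Real.norm_eq_abs]
      refine mul_le_mul_of_nonneg_left ((kernelCalculus_norm_laplacian_le _ x).trans ?_)
        (abs_nonneg ν)
      rw [finrank_euclideanSpace_fin, Nat.cast_ofNat]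
      exact mul_le_mul_of_nonneg_left (hD2u x) (by norm_num)
    have h2 : ‖fderiv ℝ (u t) x (u t x)‖ ≤ K * K :=
      (ContinuousLinearMap.le_opNorm _ _).trans (mul_le_mul (hDu x) (hU x) (norm_nonneg _) hK0)
    have e1 := norm_sub_le (ν • (Δ (u t)) x - deriv (fun s => u s x) t)
      (fderiv ℝ (u t) x (u t x))
    have e2 := norm_sub_le (ν • (Δ (u t)) x) (deriv (fun s => u s x) t)
    linarith [hut x]
  · rw [laplacian_pressure_eq hcl hS₀ ht x, abs_le]
    have hc : ‖curl (u t) x‖ ≤ ‖curlCLM‖ * K := by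
      rw [curl_eq_curlCLM]
      exact (curlCLM.le_opNorm _).trans (mul_le_mul_of_nonneg_left (hDu x) (norm_nonneg _))
    have h1 : ‖curl (u t) x‖ ^ 2 ≤ (‖curlCLM‖ * K) ^ 2 := pow_le_pow_left₀ (norm_nonneg _) hc 2
    have h2 : frobeniusNormSq (fderiv ℝ (u t) x) ≤ 3 * K ^ 2 :=
      (frobeniusNormSq_le_three_mul_norm_sq _).trans (by have := hDu x; gcongr)
    have h3 := frobeniusNormSq_nonneg (fderiv ℝ (u t) x)
    constructor <;> nlinarith [sq_nonneg ‖curl (u t) x‖]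

/-- **The Bernoulli–cloud identity, energy form (no decay of `∇G` needed).** Let `(u, p)` solve
the unforced Navier–Stokes system with viscosity `ν` classically on an open time set `S₀`, let `G`
be a flow-adapted backward kernel of `∂ₜ + u·∇ − νΔ` on `S ⊇ S₀`, dominated on `S₀` by an
integrable `M`, and assume the uniform bounds `‖u‖, ‖Du‖, ‖D²u‖, ‖∂ₜu‖ ≤ K` on `S₀ × ℝ³`. Then
for every `t ∈ S₀` the kernel-weighted energy `B(s) = ∫ ½‖u(s, x)‖² G(s, x) dx` has the derivative
`B′(t) = −∫ (u·∇p) G + ν ∫ (Δp) G − ν · adaptedEnstrophy u G t`: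
the transport-free first variation `d/dt ∫ ‖u‖²G = ∫ (∂ₜ + u·∇ − νΔ)‖u‖² · G` of the tree
(`kernelCalculus_hasDerivAt_integral_mul_kernel`), the density identity
`(∂ₜ + u·∇ − νΔ)‖u‖² = −2 u·∇p − 2ν|Du|²` and the Poisson equation `|Du|² = ‖curl u‖² − Δp`. -/
theorem bernoulliCloud_hasDerivAt_of_bounds {ν T K : ℝ}
    {u : ℝ → EuclideanSpace ℝ (Fin 3) → EuclideanSpace ℝ (Fin 3)}
    {p : ℝ → EuclideanSpace ℝ (Fin 3) → ℝ}
    {S S₀ : Set ℝ} {x₀ : EuclideanSpace ℝ (Fin 3)} {G : ℝ → EuclideanSpace ℝ (Fin 3) → ℝ}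
    {M : EuclideanSpace ℝ (Fin 3) → ℝ}
    (hG : IsAdaptedBackwardKernel ν u S T x₀ G) (hS₀ : IsOpen S₀) (hS₀S : S₀ ⊆ S)
    (hcl : IsClassicalNSSolutionOn S₀ ν 0 u p)
    (hM : Integrable M) (hGM : ∀ t ∈ S₀, ∀ x, G t x ≤ M x)
    (hU : ∀ t ∈ S₀, ∀ x, ‖u t x‖ ≤ K) (hDu : ∀ t ∈ S₀, ∀ x, ‖fderiv ℝ (u t) x‖ ≤ K)
    (hD2u : ∀ t ∈ S₀, ∀ x, ‖iteratedFDeriv ℝ 2 (u t) x‖ ≤ K)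
    (hut : ∀ t ∈ S₀, ∀ x, ‖deriv (fun s => u s x) t‖ ≤ K) {t : ℝ} (ht : t ∈ S₀) :
    HasDerivAt (fun s => ∫ x, 1 / 2 * ‖u s x‖ ^ 2 * G s x)
      (-(∫ x, fderiv ℝ (p t) x (u t x) * G t x) + ν * (∫ x, (Δ (p t)) x * G t x) -
        ν * adaptedEnstrophy u G t) t := by
  have hK0 : 0 ≤ K := (norm_nonneg _).trans (hU t ht 0)
  -- smoothness
  have hu : IsSmoothSpaceTimeOn S₀ u := hcl.smooth_velocity
  have hus : ∀ s ∈ S₀, ContDiff ℝ 2 (u s) := fun s hs =>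
    (hcl.contDiff_velocity hs).of_le (by norm_cast)
  have hq : ContDiffOn ℝ 2 (uncurry fun s x => ‖u s x‖ ^ 2) (S₀ ×ˢ univ) := by
    have hqinf : IsSmoothSpaceTimeOn S₀ fun s x => ‖u s x‖ ^ 2 :=
      ContDiffOn.congr (hu.inner hu) fun z _ => (real_inner_self_eq_norm_sq _).symm
    exact hqinf.of_le (by norm_cast)
  -- bounds on `‖u‖²` and its derivatives
  have huk : ∀ k ≤ 2, ∀ s ∈ S₀, ∀ x, ‖iteratedFDeriv ℝ k (u s) x‖ ≤ K := by
    intro k hk s hs x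
    interval_cases k
    · rw [norm_iteratedFDeriv_zero]; exact hU s hs x
    · rw [norm_iteratedFDeriv_one]; exact hDu s hs x
    · exact hD2u s hs x
  have hqK : ∀ k ≤ 2, ∀ s ∈ S₀, ∀ x,
      ‖iteratedFDeriv ℝ k (fun y => ‖u s y‖ ^ 2) x‖ ≤ 4 * K ^ 2 := by
    -- adapted from `kernelCalculus_hasDerivAt_adaptedEnstrophy_of_bounds` (tree, `q = ‖ω‖²`)
    intro k hk s hs x
    have hfun : (fun y => ‖u s y‖ ^ 2) = fun y => innerSL ℝ (u s y) (u s y) := by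
      funext y; rw [innerSL_apply_apply, real_inner_self_eq_norm_sq]
    rw [hfun]
    refine (ContinuousLinearMap.norm_iteratedFDeriv_le_of_bilinear (innerSL ℝ) (hus s hs)
      (hus s hs) x (n := k) (by exact_mod_cast hk)).trans ?_
    calc ‖innerSL ℝ (E := EuclideanSpace ℝ (Fin 3))‖ *
          ∑ i ∈ Finset.range (k + 1), (k.choose i : ℝ) *
            ‖iteratedFDeriv ℝ i (u s) x‖ * ‖iteratedFDeriv ℝ (k - i) (u s) x‖
        ≤ 1 * ∑ i ∈ Finset.range (k + 1), (k.choose i : ℝ) * K * K := by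
          refine mul_le_mul (norm_innerSL_le ℝ) (Finset.sum_le_sum fun i hi => ?_)
            (Finset.sum_nonneg fun i _ => by positivity) zero_le_one
          have hi' : i ≤ k := Nat.lt_succ_iff.mp (Finset.mem_range.mp hi)
          have h1 := huk i (hi'.trans hk) s hs x
          have h2 := huk (k - i) ((Nat.sub_le k i).trans hk) s hs x
          gcongr
      _ = 2 ^ k * K ^ 2 := by
          rw [one_mul, ← Finset.sum_mul, ← Finset.sum_mul]
          have h' : ∑ i ∈ Finset.range (k + 1), (k.choose i : ℝ) = 2 ^ k := by
            exact_mod_cast Nat.sum_range_choose k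
          rw [h']; ring
      _ ≤ 4 * K ^ 2 := by
          gcongr
          calc (2 : ℝ) ^ k ≤ 2 ^ 2 := pow_le_pow_right₀ one_le_two hk
            _ = 4 := by norm_num
  have hqt : ∀ s ∈ S₀, ∀ x, |deriv (fun r => ‖u r x‖ ^ 2) s| ≤ 2 * K * K := by
    intro s hs x
    have hline := hu.hasDerivAt_timeLine hS₀ hs x
    have hfun : (fun r => ‖u r x‖ ^ 2) = fun r => ⟪u r x, u r x⟫ := by
      funext r; rw [real_inner_self_eq_norm_sq]
    rw [hfun, (hline.inner ℝ hline).deriv, real_inner_comm, ← two_mul, abs_mul, abs_two]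
    have h := (abs_real_inner_le_norm (deriv (fun r => u r x) s) (u s x)).trans
      (mul_le_mul (hut s hs x) (hU s hs x) (norm_nonneg _) hK0)
    linarith
  -- Step 1: the transport-free first variation with `q = ‖u‖²`, then the density identity
  set Kq : ℝ := max (4 * K ^ 2) (2 * K * K)
  have key := kernelCalculus_hasDerivAt_integral_mul_kernel (q := fun s x => ‖u s x‖ ^ 2)
    (K := Kq) (U := K) hG hS₀ hS₀S hM hGM (fun s hs => (hus s hs).of_le one_le_two)
    (fun s hs => hcl.divFree s hs) hU hq
    (fun k hk s hs x => (hqK k hk s hs x).trans (le_max_left _ _))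
    (fun s hs x => (hqt s hs x).trans (le_max_right _ _)) ht
  have key2 : HasDerivAt (fun s => ∫ x, ‖u s x‖ ^ 2 * G s x)
      (∫ x, (-(2 * fderiv ℝ (p t) x (u t x)) - 2 * ν * frobeniusNormSq (fderiv ℝ (u t) x)) *
        G t x) t :=
    key.congr_deriv (integral_congr_ae (Eventually.of_forall fun x =>
      congrArg (fun r => r * G t x) (bernoulliCloud_density hcl hS₀ ht x)))
  have key3 : HasDerivAt (fun s => ∫ x, 1 / 2 * ‖u s x‖ ^ 2 * G s x)
      (1 / 2 * ∫ x, (-(2 * fderiv ℝ (p t) x (u t x)) -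
        2 * ν * frobeniusNormSq (fderiv ℝ (u t) x)) * G t x) t := by
    refine (key2.const_mul (1 / 2 : ℝ)).congr_of_eventuallyEq (Eventually.of_forall fun s => ?_)
    show ∫ x, 1 / 2 * ‖u s x‖ ^ 2 * G s x = 1 / 2 * ∫ x, ‖u s x‖ ^ 2 * G s x
    rw [← integral_const_mul]
    exact integral_congr_ae (Eventually.of_forall fun x => by ring)
  refine key3.congr_deriv ?_
  -- Step 2: rearrange, using the Poisson equation `|Du|² = ‖curl u‖² − Δp`
  have hpt : ContDiff ℝ 2 (p t) := (hcl.contDiff_pressure ht).of_le (by norm_cast)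
  have hGi : Integrable (G t) := hG.integrable (hS₀S ht)
  have hpb := bernoulliCloud_pressure_bounds hcl hS₀ ht (hU t ht) (hDu t ht) (hD2u t ht) (hut t ht)
  have hbdd : ∀ {φ : EuclideanSpace ℝ (Fin 3) → ℝ} {c : ℝ}, Continuous φ → (∀ x, |φ x| ≤ c) →
      Integrable fun x => φ x * G t x := fun hφ hc =>
    hGi.bdd_mul hφ.aestronglyMeasurable (Eventually.of_forall fun x => by
      rw [Real.norm_eq_abs]; exact hc x)
  have hI3 : Integrable fun x => fderiv ℝ (p t) x (u t x) * G t x := by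
    refine hbdd (((hpt.continuous_fderiv (by norm_num)).clm_apply (hus t ht).continuous))
      (c := (|ν| * (3 * K) + K + K * K) * K) fun x => ?_
    rw [← Real.norm_eq_abs]
    exact (ContinuousLinearMap.le_opNorm _ _).trans (mul_le_mul (hpb x).1 (hU t ht x)
      (norm_nonneg _) (by positivity))
  have hI4 : Integrable fun x => frobeniusNormSq (fderiv ℝ (u t) x) * G t x := by
    refine hbdd (continuous_frobeniusNormSq_fderiv (hus t ht) (by norm_num)) (c := 3 * K ^ 2)
      fun x => ?_
    rw [abs_of_nonneg (frobeniusNormSq_nonneg _)]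
    exact (frobeniusNormSq_le_three_mul_norm_sq _).trans (by have := hDu t ht x; gcongr)
  have hI6 : Integrable fun x => (Δ (p t)) x * G t x :=
    hbdd (continuous_laplacian hpt) fun x => (hpb x).2
  have hI5 : Integrable fun x => ‖curl (u t) x‖ ^ 2 * G t x := by
    refine hbdd (c := (‖curlCLM‖ * K) ^ 2) ?_ fun x => ?_
    · rw [curl_eq_curlCLM_comp]
      exact ((curlCLM.continuous.comp ((hus t ht).continuous_fderiv (by norm_num))).norm).pow 2
    · rw [abs_of_nonneg (sq_nonneg _), curl_eq_curlCLM]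
      exact pow_le_pow_left₀ (norm_nonneg _) ((curlCLM.le_opNorm _).trans
        (mul_le_mul_of_nonneg_left (hDu t ht x) (norm_nonneg _))) 2
  have hPois : ∫ x, frobeniusNormSq (fderiv ℝ (u t) x) * G t x =
      adaptedEnstrophy u G t - ∫ x, (Δ (p t)) x * G t x := by
    rw [adaptedEnstrophy_apply, ← integral_sub hI5 hI6]
    refine integral_congr_ae (Eventually.of_forall fun x => ?_)
    show frobeniusNormSq (fderiv ℝ (u t) x) * G t x =
      ‖curl (u t) x‖ ^ 2 * G t x - (Δ (p t)) x * G t x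
    rw [laplacian_pressure_eq hcl hS₀ ht x]; ring
  have hL : ∫ x, (-(2 * fderiv ℝ (p t) x (u t x)) - 2 * ν * frobeniusNormSq (fderiv ℝ (u t) x)) *
      G t x = -(2 * ∫ x, fderiv ℝ (p t) x (u t x) * G t x) -
        2 * ν * ∫ x, frobeniusNormSq (fderiv ℝ (u t) x) * G t x := by
    have h1 : ∫ x, (-(2 * fderiv ℝ (p t) x (u t x)) -
        2 * ν * frobeniusNormSq (fderiv ℝ (u t) x)) * G t x =
        ∫ x, (-(2 * (fderiv ℝ (p t) x (u t x) * G t x)) -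
          2 * ν * (frobeniusNormSq (fderiv ℝ (u t) x) * G t x)) :=
      integral_congr_ae (Eventually.of_forall fun x => by ring)
    have hA : Integrable fun x => -(2 * (fderiv ℝ (p t) x (u t x) * G t x)) :=
      (hI3.const_mul 2).neg
    have hB : Integrable fun x => 2 * ν * (frobeniusNormSq (fderiv ℝ (u t) x) * G t x) :=
      hI4.const_mul (2 * ν)
    rw [h1, integral_sub hA hB, integral_neg, integral_const_mul, integral_const_mul]
  rw [hL, hPois]
  ring

/-- **THE BERNOULLI–CLOUD IDENTITY.** Let `(u, p)` solve the unforced Navier–Stokes system with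
viscosity `ν` classically on an open time set `S₀`, let `G` be a flow-adapted backward kernel of
`∂ₜ + u·∇ − νΔ` on `S ⊇ S₀` dominated on `S₀` by an integrable `M`, and assume on `S₀ × ℝ³` the
uniform bounds `‖u‖, ‖Du‖, ‖D²u‖, ‖∂ₜu‖ ≤ K`, the linear growth `|p(t, x)| ≤ K(1 + ‖x‖)`, and the
integrability of `(1 + ‖x‖)‖∇G(t)‖` and `(1 + ‖x‖)|ΔG(t)|` for `t ∈ S₀`. Then for every `t ∈ S₀`
the kernel-weighted energy `B(s) = ∫ ½‖u(s, x)‖² G(s, x) dx` satisfies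
`B′(t) = ∫ p(t) (u·∇G(t) + νΔG(t)) − ν · adaptedEnstrophy u G t`
(equivalently, by the adjoint equation `∂ₜG = −(u·∇G + νΔG)`: `ν H = −∫ p ∂ₜG − dB/dt`; a steady
cloud has `H = 0`). Proof: the energy form `bernoulliCloud_hasDerivAt_of_bounds` and the two
whole-space integrations by parts `−∫ (u·∇p) G = ∫ p (u·∇G)` (`div u = 0`) and
`∫ (Δp) G = ∫ p ΔG` of `…BernoulliCloudIdentityIBP`, with `‖∇p‖`, `|Δp|` bounded by
`bernoulliCloud_pressure_bounds`. -/
theorem bernoulliCloud_hasDerivAt {ν T K : ℝ}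
    {u : ℝ → EuclideanSpace ℝ (Fin 3) → EuclideanSpace ℝ (Fin 3)}
    {p : ℝ → EuclideanSpace ℝ (Fin 3) → ℝ}
    {S S₀ : Set ℝ} {x₀ : EuclideanSpace ℝ (Fin 3)} {G : ℝ → EuclideanSpace ℝ (Fin 3) → ℝ}
    {M : EuclideanSpace ℝ (Fin 3) → ℝ}
    (hG : IsAdaptedBackwardKernel ν u S T x₀ G) (hS₀ : IsOpen S₀) (hS₀S : S₀ ⊆ S)
    (hcl : IsClassicalNSSolutionOn S₀ ν 0 u p)
    (hM : Integrable M) (hGM : ∀ t ∈ S₀, ∀ x, G t x ≤ M x)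
    (hU : ∀ t ∈ S₀, ∀ x, ‖u t x‖ ≤ K) (hDu : ∀ t ∈ S₀, ∀ x, ‖fderiv ℝ (u t) x‖ ≤ K)
    (hD2u : ∀ t ∈ S₀, ∀ x, ‖iteratedFDeriv ℝ 2 (u t) x‖ ≤ K)
    (hut : ∀ t ∈ S₀, ∀ x, ‖deriv (fun s => u s x) t‖ ≤ K)
    (hp : ∀ t ∈ S₀, ∀ x, |p t x| ≤ K * (1 + ‖x‖))
    (hDG : ∀ t ∈ S₀, Integrable fun x => (1 + ‖x‖) * ‖fderiv ℝ (G t) x‖)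
    (hΔG : ∀ t ∈ S₀, Integrable fun x => (1 + ‖x‖) * |(Δ (G t)) x|) {t : ℝ} (ht : t ∈ S₀) :
    HasDerivAt (fun s => ∫ x, 1 / 2 * ‖u s x‖ ^ 2 * G s x)
      ((∫ x, p t x * (fderiv ℝ (G t) x (u t x) + ν * (Δ (G t)) x)) -
        ν * adaptedEnstrophy u G t) t := by
  refine (bernoulliCloud_hasDerivAt_of_bounds hG hS₀ hS₀S hcl hM hGM hU hDu hD2u hut
    ht).congr_deriv ?_
  have hpt : ContDiff ℝ 2 (p t) := (hcl.contDiff_pressure ht).of_le (by norm_cast)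
  have hut2 : ContDiff ℝ 2 (u t) := (hcl.contDiff_velocity ht).of_le (by norm_cast)
  have hGt : ContDiff ℝ 2 (G t) := hG.contDiff_slice (hS₀S ht)
  have hGi : Integrable (G t) := hG.integrable (hS₀S ht)
  have hpb := bernoulliCloud_pressure_bounds hcl hS₀ ht (hU t ht) (hDu t ht) (hD2u t ht) (hut t ht)
  -- one constant for the integrations by parts
  set K' : ℝ := max (max K (|ν| * (3 * K) + K + K * K)) ((‖curlCLM‖ * K) ^ 2 + 3 * K ^ 2)
  have hKK' : K ≤ K' := (le_max_left _ _).trans (le_max_left _ _)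
  have hp0 : ∀ x, |p t x| ≤ K' * (1 + ‖x‖) := fun x =>
    (hp t ht x).trans (mul_le_mul_of_nonneg_right hKK' (by positivity))
  have hp1 : ∀ x, ‖fderiv ℝ (p t) x‖ ≤ K' := fun x =>
    (hpb x).1.trans ((le_max_right _ _).trans (le_max_left _ _))
  have hp2 : ∀ x, |(Δ (p t)) x| ≤ K' := fun x => (hpb x).2.trans (le_max_right _ _)
  have hu' : ∀ x, ‖u t x‖ ≤ K' := fun x => (hU t ht x).trans hKK'
  -- the two integrations by parts
  have hIBP1 : ∫ x, p t x * fderiv ℝ (G t) x (u t x) = -∫ x, fderiv ℝ (p t) x (u t x) * G t x :=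
    cloudIBP_integral_mul_fderiv_apply (hpt.of_le one_le_two) (hGt.of_le one_le_two)
      (hut2.of_le one_le_two) (hcl.divFree t ht) hp0 hp1 hu' hGi (hDG t ht)
  have hIBP2 : ∫ x, p t x * (Δ (G t)) x = ∫ x, (Δ (p t)) x * G t x :=
    cloudIBP_integral_mul_laplacian hpt hGt hp0 hp1 hp2 hGi (hΔG t ht)
  -- splitting the pressure integral
  have hI1 : Integrable fun x => p t x * fderiv ℝ (G t) x (u t x) := by
    refine ((hDG t ht).const_mul (K' * K')).mono'
      ((hcl.contDiff_pressure ht).continuous.mul ((hGt.continuous_fderiv (by norm_num)).clm_apply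
        hut2.continuous)).aestronglyMeasurable (Eventually.of_forall fun x => ?_)
    rw [norm_mul, Real.norm_eq_abs, Real.norm_eq_abs]
    calc |p t x| * |fderiv ℝ (G t) x (u t x)| ≤ (K' * (1 + ‖x‖)) * (‖fderiv ℝ (G t) x‖ * K') := by
          refine mul_le_mul (hp0 x) ?_ (abs_nonneg _) ((abs_nonneg _).trans (hp0 x))
          rw [← Real.norm_eq_abs]
          exact (ContinuousLinearMap.le_opNorm _ _).trans (by gcongr; exact hu' x)
      _ = K' * K' * ((1 + ‖x‖) * ‖fderiv ℝ (G t) x‖) := by ring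
  have hI2 : Integrable fun x => p t x * (Δ (G t)) x := by
    refine ((hΔG t ht).const_mul K').mono'
      ((hcl.contDiff_pressure ht).continuous.mul (continuous_laplacian hGt)).aestronglyMeasurable
      (Eventually.of_forall fun x => ?_)
    rw [norm_mul, Real.norm_eq_abs, Real.norm_eq_abs]
    calc |p t x| * |(Δ (G t)) x| ≤ (K' * (1 + ‖x‖)) * |(Δ (G t)) x| :=
          mul_le_mul_of_nonneg_right (hp0 x) (abs_nonneg _)
      _ = K' * ((1 + ‖x‖) * |(Δ (G t)) x|) := by ring
  have hsplit : ∫ x, p t x * (fderiv ℝ (G t) x (u t x) + ν * (Δ (G t)) x) =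
      (∫ x, p t x * fderiv ℝ (G t) x (u t x)) + ν * ∫ x, p t x * (Δ (G t)) x := by
    rw [← integral_const_mul, ← integral_add hI1 ((hI2.const_mul ν))]
    exact integral_congr_ae (Eventually.of_forall fun x => by ring)
  rw [hsplit, hIBP1, hIBP2]

end R3

end Summit.NavierStokesRegularity.NavierStokesRegularity.Theorems.AdaptedFrequencyConverges.CloudFrameEffectiveTsai

end
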